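import Summits.ResolutionOfSingularities.ResolutionOfSingularities.Theorems.EquisingularLiftEquisingularLiftNatF102HomFrameTransition
import Literature.AlgebraicGeometry.Modules.RankOneCocycle
import HarnessLib

/-!
# [OURS · L1 W4.5(b) · EL♮(3) (L) brick C2, sub-brick K1] The cocycle class of `𝓗om(L, Q)` for line bundles:
# `[𝓗om(L, Q)] = [Q] · [L]⁻¹` in `Ȟ¹(X, 𝒪_X^×)`

Cell res-hironaka, LADDER-RESOLUTION rung L, slot W4.5(b), crux chain w45b: EL♮(3) = stmt-ResolutionOfSingularities-20148, brick C2 of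
`Tower.hLift_of_bricks` (res-L1-w45b-stub-4 skeleton e8194db888c4f60c; census `Cruxes/EquisingularLiftNatThree/Lines/C2-CENSUS-res-type-027.md`).
Seat res-type-027 g15. `--supports stmt-ResolutionOfSingularities-20148 --as helper`. OURS; NOT a statement of any manuscript; AI-written,
weaker than expert review. Definition-free; standard axioms.

The Euler identification of brick C2 is run in COCYCLE-CLASS currency (tree `Modules/UnitCocycle.CechPic`, `Modules/DeterminantCocycle`):
this file supplies the Q-side rule. For `𝒪_X`-modules `L`, `Q` with frame systems of constant rank one, the matrix-unit frames
`homFrame` (tree `Modules/SheafHomFrames`) on the intersections `U^L_x ∩ U^Q_x` form a rank-one frame system of `𝓗om(L, Q)` whose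
determinant cocycle is `g^Q_{xy} · g^L_{yx}` (Kronecker rule `F102.transition_homFrame`, res-D-pv-036 p58xxxx), hence
`[𝓗om(L, Q)] = [Q] · [L]⁻¹` (`exists_frameSystem_sheafHom_rank_one`, `detClass_sheafHom_of_hasRank_one`) and `𝓗om(L, Q)` has rank one. Definition-free.
[cite: Hartshorne1977, II Ex. 5.1 (b), III Ex. 4.5] [folklore]
-/

noncomputable section

open CategoryTheory AlgebraicGeometry Opposite TopologicalSpace
open Literature.AlgebraicGeometry.Modules Literature.AlgebraicGeometry.Motives
open Summit.ResolutionOfSingularities.ResolutionOfSingularities.Cruxes.EquisingularLiftNat.F102 (transition_homFrame)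

set_option linter.dupNamespace false

namespace Summit.ResolutionOfSingularities.ResolutionOfSingularities.Cruxes.EquisingularLiftNat.Sections

universe u

variable {X : Scheme.{u}} {L Q : X.Modules}

/-- The index type of a rank-one frame system at a point is a subsingleton. [folklore] -/
theorem subsingleton_index_of_rank_one (F : FrameSystem L) (hL : ∀ x, F.rank x = 1) (x : X) : Subsingleton (F.I x) := by
  haveI : Subsingleton (Fin (F.rank x)) := by rw [hL x]; infer_instance
  exact (F.enum x).subsingleton

/-- The index type of a rank-one frame system at a point is nonempty. [folklore] -/
theorem nonempty_index_of_rank_one (F : FrameSystem L) (hL : ∀ x, F.rank x = 1) (x : X) : Nonempty (F.I x) :=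
  ⟨(F.enum x).symm (Fin.cast (hL x).symm 0)⟩

/-- **`[𝓗om(L, Q)] = [Q] · [L]⁻¹`** for rank-one frame systems: `𝓗om(L, Q)` carries a rank-one frame system — on `U^L_x ∩ U^Q_x` the
matrix-unit frame `homFrame (e^L_x|) (e^Q_x|)`, indexed by `I^L_x × I^Q_x ≃ Fin 1` — whose transition scalars are
`T(e^L_y, e^L_x) · T(e^Q_x, e^Q_y)` (Kronecker rule), so that its cocycle class is the class of `Q` times the inverse of the class of `L`.
[cite: Hartshorne1977, II Ex. 5.1 (b), III Ex. 4.5] -/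
theorem exists_frameSystem_sheafHom_rank_one (FL : FrameSystem L) (FQ : FrameSystem Q)
    (hL : ∀ x, FL.rank x = 1) (hQ : ∀ x, FQ.rank x = 1) :
    ∃ FH : FrameSystem (sheafHom L Q), (∀ x, FH.rank x = 1) ∧ (∀ x, FH.U x = FL.U x ⊓ FQ.U x) ∧
      CechPic.mk FH.cocycle = CechPic.mk FQ.cocycle * (CechPic.mk FL.cocycle)⁻¹ := by
  -- the Hom-frame system
  let FH : FrameSystem (sheafHom L Q) :=
    { U := fun x => FL.U x ⊓ FQ.U x
      mem := fun x => ⟨FL.mem x, FQ.mem x⟩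
      I := fun x => FL.I x × FQ.I x
      rank := fun _ => 1
      enum := fun x => ((FL.enum x).prodCongr (FQ.enum x)).trans (finProdFinEquiv.trans (finCongr (by rw [hL x, hQ x])))
      frame := fun x =>
        letI : Fintype (FL.I x) := Fintype.ofEquiv _ (FL.enum x).symm
        letI : Fintype (FQ.I x) := Fintype.ofEquiv _ (FQ.enum x).symm
        homFrame (SheafOfModules.restrictTrivialisation (R := X.ringCatSheaf) (homOfLE inf_le_left) (FL.frame x))
          (SheafOfModules.restrictTrivialisation (R := X.ringCatSheaf) (homOfLE inf_le_right) (FQ.frame x)) }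
  -- its transition scalars
  have hg : ∀ (x y : X) (V : X.Opens) (hx : V ≤ FL.U x ⊓ FQ.U x) (hy : V ≤ FL.U y ⊓ FQ.U y)
      (i : FL.I x) (j : FQ.I x) (i' : FL.I y) (j' : FQ.I y),
      FH.cocycle.g x y V hx hy =
        transition (FL.frame y) (FL.frame x) (homOfLE (hy.trans inf_le_left)) (homOfLE (hx.trans inf_le_left)) i' i *
          transition (FQ.frame x) (FQ.frame y) (homOfLE (hx.trans inf_le_right)) (homOfLE (hy.trans inf_le_right)) j j' := by
    intro x y V hx hy i j i' j'
    letI : Fintype (FL.I x) := Fintype.ofEquiv _ (FL.enum x).symm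
    letI : Fintype (FQ.I x) := Fintype.ofEquiv _ (FQ.enum x).symm
    letI : Fintype (FL.I y) := Fintype.ofEquiv _ (FL.enum y).symm
    letI : Fintype (FQ.I y) := Fintype.ofEquiv _ (FQ.enum y).symm
    haveI := subsingleton_index_of_rank_one FL hL x
    haveI := subsingleton_index_of_rank_one FL hL y
    haveI := subsingleton_index_of_rank_one FQ hQ x
    haveI := subsingleton_index_of_rank_one FQ hQ y
    rw [FrameSystem.cocycle_g]
    dsimp only [FH, FrameSystem.cocycle]
    rw [transitionDet_eq_of_subsingleton _ _ _ _ _ _ (i, j) (i', j'), transition_homFrame,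
      transition_restrictTrivialisation (FL.frame y) (FL.frame x) (homOfLE (inf_le_left : FL.U y ⊓ FQ.U y ≤ FL.U y))
        (homOfLE (inf_le_left : FL.U x ⊓ FQ.U x ≤ FL.U x)) (homOfLE hy) (homOfLE hx),
      transition_restrictTrivialisation (FQ.frame x) (FQ.frame y) (homOfLE (inf_le_right : FL.U x ⊓ FQ.U x ≤ FQ.U x))
        (homOfLE (inf_le_right : FL.U y ⊓ FQ.U y ≤ FQ.U y)) (homOfLE hx) (homOfLE hy)]
    rfl
  refine ⟨FH, fun _ => rfl, fun _ => rfl, ?_⟩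
  rw [← CechPic.mk_inv, ← CechPic.mk_mul]
  refine CechPic.sound (UnitCocycle.equiv_of_eq _ _ (fun x => FL.U x ⊓ FQ.U x) (fun x => ⟨FL.mem x, FQ.mem x⟩) (fun _ => le_rfl)
    (fun x => le_of_eq (inf_comm (FL.U x) (FQ.U x))) fun x y V hx hy => ?_)
  obtain ⟨i⟩ := nonempty_index_of_rank_one FL hL x
  obtain ⟨j⟩ := nonempty_index_of_rank_one FQ hQ x
  obtain ⟨i'⟩ := nonempty_index_of_rank_one FL hL y
  obtain ⟨j'⟩ := nonempty_index_of_rank_one FQ hQ y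
  haveI := subsingleton_index_of_rank_one FL hL x
  haveI := subsingleton_index_of_rank_one FL hL y
  haveI := subsingleton_index_of_rank_one FQ hQ x
  haveI := subsingleton_index_of_rank_one FQ hQ y
  rw [hg x y V _ _ i j i' j']
  change FQ.cocycle.g x y V _ _ * FL.cocycle.g y x V _ _ = _
  rw [FrameSystem.cocycle_g, FrameSystem.cocycle_g, transitionDet_eq_of_subsingleton _ _ _ _ _ _ j j',
    transitionDet_eq_of_subsingleton _ _ _ _ _ _ i' i, mul_comm]

/-- **`𝓗om(L, Q)` of two rank-one modules has rank one and determinant class `[Q] · [L]⁻¹`.**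
[cite: Hartshorne1977, II Ex. 5.1 (b), III Ex. 4.5] -/
theorem detClass_sheafHom_of_hasRank_one (hL : HasRank L 1) (hQ : HasRank Q 1)
    (hLf : IsFiniteLocallyFree L) (hQf : IsFiniteLocallyFree Q) (hHf : IsFiniteLocallyFree (sheafHom L Q)) :
    HasRank (sheafHom L Q) 1 ∧ detClass hHf = detClass hQf * (detClass hLf)⁻¹ := by
  obtain ⟨FL, hFL⟩ := exists_frameSystem_of_hasRank hL
  obtain ⟨FQ, hFQ⟩ := exists_frameSystem_of_hasRank hQ
  obtain ⟨FH, hFH, -, hcl⟩ := exists_frameSystem_sheafHom_rank_one FL FQ hFL hFQ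
  exact ⟨FH.hasRank 1 hFH, by rw [detClass_eq_mk hHf FH, detClass_eq_mk hQf FQ, detClass_eq_mk hLf FL, hcl]⟩

/-- `𝓗om(L, Q)` of two rank-one modules is finite locally free (so that `detClass` applies). [folklore] -/
theorem isFiniteLocallyFree_sheafHom_of_hasRank_one (hL : HasRank L 1) (hQ : HasRank Q 1) :
    IsFiniteLocallyFree (sheafHom L Q) := by
  obtain ⟨FL, hFL⟩ := exists_frameSystem_of_hasRank hL
  obtain ⟨FQ, hFQ⟩ := exists_frameSystem_of_hasRank hQ
  obtain ⟨FH, -, -, -⟩ := exists_frameSystem_sheafHom_rank_one FL FQ hFL hFQ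
  exact FH.isFiniteLocallyFree

end Summit.ResolutionOfSingularities.ResolutionOfSingularities.Cruxes.EquisingularLiftNat.Sections

end
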